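/-
Copyright: the b2b-balaban cell (near-miss cell 7), T⁴-continuum fan-out; row NE7b ROUND-2 swarm, seat
t4-ne7b-formalise-leaf-05 gen 4 (row S6g′ INSTANCE of `t4/b2b-balaban-t4-ne7b-p1/LEAVES-NE7b.md`, owner's rulings
R-OWNER-22-23∕-24 and ACK l.12945: T3a part 3 «laws», file B2).  Released under the licence of the surrounding project.
-/
import Summits.QuantumFields.BalabanUV.T4Continuum.Support.HistoryJoinsPlacedTagged
import Summits.QuantumFields.BalabanUV.T4Continuum.Support.HistoryJoinsPlacedEnd

/-!
# The reading laws of the concrete zone `zoneP` and the count's END for it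
# (row S6g′ INSTANCE, T3a part 3 «laws», file B2 «LAWS»)

Summits-side support leaf of the T⁴-continuum cell (rung (B)+1 on a FINITE torus only; NOT infinite volume, NOT the
mass gap, NOT the Clay statement; NOT a proof of the spine estimate NE7b).  Row NE7b, route «COUNT», row S6g′.
[folklore] composition BY NAME of leaf-04 gen 3's law for pieces under cluster contact
(`HistoryZoneMassCluster.card_regZoneD_le_self` ∕ `linked_regZoneD_pieces`), file B1's cluster-contact binder and
root block (`HistoryJoinsPlacedTagged.hconn_zoneP` ∕ `root_blk_mem_regZoneD`), leaf-02 gen 4's linkedness × cardinality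
(`HistoryJoinsSupExtent.cdist_le_of_linked_real`), file A's zone and cheap laws (`HistoryJoinsPlacedZone`) and gen 3's
END for placements carrying templates (`HistoryJoinsPlacedEnd.card_S_le_exp_pow_placed` ∕ `hlawR_of_laws` ∕
`total_potential_le`) with leaf-10 gen 4's template count (`HistoryJoinsTemplates.A` ∕ `A_le_exp`).  Nothing is quoted
from print, nothing printed is asserted, no `[cite:]` tag, no `Prop` fact minted, no definition.

WHAT.  Letters (leaf-04 gen 3's, symbolic — trigger c2∕c6): `A₁ = (2·cth c 1 s + 1)^d`, `A = A₁·5^d`,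
`C₁ = (2c+1)^d`, `Cr = 4·2^d`, `WB = 2A₁·C₁·Cr`, `WM = 4A`, `γ′ = 2A`, link radius `ρℓ = max 1 (2c+2)`; stride `s ≥ 1`,
advance `m` with `lv u + m ≤ lv (u+s)`, smallness `A·ρℓ ≤ L^m∕2`, decay `0 ≤ θ ≤ 1`, `θ^s ≥ 1∕2`.
* §4 **`facts_zoneP`**: for a chronological dated structure `Z` placed canonically admissibly (`p ∈ Sany (zoneP …) ρ c₀
  step Z`) with a NON-EMPTY zone at a step `t ∈ [ftime Z, K]`: the zone is in range of its level, `ρℓ`-linked,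
  contains the root cell's level-`t` block, and has `# ≤ zmass id θ WB WM t Z + γ′` (renewals peeled, then leaf-04
  gen 3's law on the tagged tree `addrTag [] Z` with `reg := regOf c₀ p`, its binders from file A ∕ B1);
* §5 on a structure `G` chronological and dated strictly before `T ≤ K + 1` (every join step `≤ K`):
  **`hfacts_zoneP`** (leaf-02 gen 4's four reading facts at the joins), **`hlawM_zoneP`** (the per-placement
  cardinality law at all parts of all joins), **`hlawC_zoneP`** (the cyclic-distance law at the parts:
  `cdist(u, root block) ≤ ρℓ·zmass + ρℓ·γ′`), **`hlawT_zoneP'`** (file A's root-template law, binder shape);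
* §6 **`card_S_le_exp_pow_zoneP`** — THE COUNT's END FOR THE CONCRETE ZONE: for every such `G`, every root datum `z`
  and every entropy input `ENT step G ≤ κE·F + μE·partnerAges + Ξ`,
  `#S (zoneP …) ρ c₀ step G z ≤ exp((2 + κM + κρ + κE)·F + Ξ)·(L^d·e^{μE})^{partnerAges step G}` with
  `κM = (WB+WM)∕(1−θ) + 2γ′`, `κρ = 2(d₁ + (2d+d₁)·ρℓγ′) + (2d+d₁)·(ρℓ(WB+WM)∕(1−θ) + Cr)`, `d₁ = 2·log(2d+1)`
  (gen 3's END at `sh := id`, `tsz := card`, `A := HistoryJoinsTemplates.A d M`, `a₁ := 0`, `C₀ := 1`).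
What stays DISPLAYED for the twin END (file `HistoryJoinsPlacedTwin`): `Dated`∕`Chrono` of the sorted flat twin
(free on pedigrees under `HeadOldest`), `T ≤ K + 1`, the entropy input (`HistoryJoinsSortTwin.ENT_le_gen_sortR`), the
stride∕smallness∕decay side conditions, `1 ≤ L`, `1 ≤ n`, `LevelFn K lv`.

HONEST SCOPE.  Bookkeeping∕geometry over OUR carriers; the identification of Bałaban's regions with the reading stays
H3; nothing of H3∕(B)∕BetaPertH touched; `BirthShapeNodup` NOT retired here; NE7b NOT proved.  HONEST DEPENDENCY
(cell): continuum YM on T⁴ ⇐ BetaPertH ∧ nine spine estimates (0/9 proved); BetaPertH ⇐ (D1) ∧ (D4) ∧ CAP+tail;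
G-an2-4 gates asym, D1 and NE2/3/4.  This file changes none of it.
-/

open Finset
open Literature.MathematicalPhysics.QuantumFieldTheory.Balaban1983to89
open Literature.MathematicalPhysics.QuantumFieldTheory.Balaban1983to89.B13ScaleTransfer (Pt)
open T4PersistenceDictionary T4PartnerMultiplicity T4BranchingRecordsGas
open Summit.QuantumFields.BalabanUV.T4Continuum.PlacementSkeleton
open Summit.QuantumFields.BalabanUV.T4Continuum.ZoneTorus
open Summit.QuantumFields.BalabanUV.T4Continuum.ZoneSkeleton
open Summit.QuantumFields.BalabanUV.T4Continuum.HistoryZones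
open Summit.QuantumFields.BalabanUV.T4Continuum.HistoryZoneMass
open Summit.QuantumFields.BalabanUV.T4Continuum.HistoryZoneEvolve
open Summit.QuantumFields.BalabanUV.T4Continuum.HistoryZoneEvolveLevels
open Summit.QuantumFields.BalabanUV.T4Continuum.HistoryZoneMassLaw
open Summit.QuantumFields.BalabanUV.T4Continuum.HistoryZoneMassJoins
open Summit.QuantumFields.BalabanUV.T4Continuum.HistoryZoneMassPieces
open Summit.QuantumFields.BalabanUV.T4Continuum.HistoryZoneMassCluster
open Summit.QuantumFields.BalabanUV.T4Continuum.HistoryZoneMassBridge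
open Summit.QuantumFields.BalabanUV.T4Continuum.HistoryJoins
open Summit.QuantumFields.BalabanUV.T4Continuum.HistoryJoinsAdm
open Summit.QuantumFields.BalabanUV.T4Continuum.HistoryJoinsTag
open Summit.QuantumFields.BalabanUV.T4Continuum.HistoryJoinsSupTorus
open Summit.QuantumFields.BalabanUV.T4Continuum.HistoryJoinsSupExtent
open Summit.QuantumFields.BalabanUV.T4Continuum.HistoryRegionTemplates
open Summit.QuantumFields.BalabanUV.T4Continuum.HistoryJoinsTemplates
open Summit.QuantumFields.BalabanUV.T4Continuum.HistoryJoinsPlacedZone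
open Summit.QuantumFields.BalabanUV.T4Continuum.HistoryJoinsSup
open Summit.QuantumFields.BalabanUV.T4Continuum.HistoryJoinsEntropyBudget
open Summit.QuantumFields.BalabanUV.T4Continuum.HistoryJoinsPlaced
open Summit.QuantumFields.BalabanUV.T4Continuum.HistoryJoinsPlacedEnd
open Summit.QuantumFields.BalabanUV.T4Continuum.HistoryJoinsPlacedTagged

namespace Summit.QuantumFields.BalabanUV.T4Continuum.HistoryJoinsPlacedLaws

noncomputable section

open scoped Classical

variable {d n L K D M : ℕ} {lv : ℕ → ℕ} {c : ℕ} {c₀ : TCell d (n * L ^ K) × Template d M}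
  {p : Addr D → TCell d (n * L ^ K) × Template d M}
  {R : Type*} [LinearOrder R] (ρ : (Addr D → TCell d (n * L ^ K) × Template d M) → R)

/-! ## §4 The four reading facts for one placed structure -/

/-- **THE FOUR READING FACTS FOR ONE CANONICALLY ADMISSIBLY PLACED BIRTH OR MERGER** with a non-empty zone at a step
`t ∈ [ftime, K]`: in range, `max 1 (2c+2)`-linked, root block inside, cardinality law (leaf-04 gen 3's letters with
`Cr = 4·2^d`, `ρr = 1`). [folklore] -/
theorem facts_zoneP_of_ne_renew (hL : 1 ≤ L) (hn : 1 ≤ n) (hlv : LevelFn K lv) {Z : Gen PEv}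
    (hZ : ∀ (Y : Gen PEv) (e : PEv) (h : ℕ), Z ≠ Gen.renew Y e h) (hchr : Chrono PEv.step Z) {s₀ : Bool} {T : ℕ}
    (hD : Dated PEv.step s₀ T Z) (hp : p ∈ Sany (zoneP n L K lv c c₀) ρ c₀ PEv.step Z)
    {s m : ℕ} (hs : 1 ≤ s) (hm : ∀ u : ℕ, u + s ≤ K → lv u + m ≤ lv (u + s))
    (hsmall : (((2 * cth c 1 s + 1) ^ d : ℕ) : ℝ) * (5 : ℝ) ^ d * ((max 1 (2 * c + 2) : ℕ) : ℝ) ≤ (L : ℝ) ^ m / 2)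
    {θ : ℝ} (hθ0 : 0 ≤ θ) (hθ1 : θ ≤ 1) (hθs : 1 / 2 ≤ θ ^ s)
    {t : ℕ} (hft : ftime PEv.step Z ≤ t) (htK : t ≤ K) (hne : (zoneP n L K lv c c₀ t Z p).Nonempty) :
    InRange (n * L ^ (K - lv t)) (zoneP n L K lv c c₀ t Z p) ∧
      Linked (n * L ^ (K - lv t)) (max 1 (2 * c + 2)) (zoneP n L K lv c c₀ t Z p) ∧
      blk L (lv t) (evalA c₀ p (rootAddr Z)).1 ∈ zoneP n L K lv c c₀ t Z p ∧
      ((zoneP n L K lv c c₀ t Z p).card : ℝ) ≤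
        zmass (id : PEv → PEv) θ
            (2 * (((2 * cth c 1 s + 1) ^ d : ℕ) : ℝ) * ((((2 * c + 1) ^ d : ℕ) : ℝ) * (4 * 2 ^ d)))
            (4 * ((((2 * cth c 1 s + 1) ^ d : ℕ) : ℝ) * (5 : ℝ) ^ d)) t Z +
          2 * ((((2 * cth c 1 s + 1) ^ d : ℕ) : ℝ) * (5 : ℝ) ^ d) := by
  obtain ⟨hok, hlt⟩ := ok_of_nonempty hne
  have hzone := zoneP_eq_of_ok (c := c) hok hlt
  obtain ⟨-, hadm⟩ := mem_Sany.1 hp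
  -- the law's binders on the tagged tree
  have hchrT : Chrono (PEv.step ∘ Prod.snd) (addrTag [] Z) := chrono_addrTag PEv.step hchr []
  have hrange : ∀ b ∈ births (addrTag [] Z), InRange (n * L ^ (K - lv (Prod.snd b).step)) (regOf n L K lv c₀ p b) :=
    fun b _ => regOf_inRange hL hn b
  have hregL : ∀ b ∈ births (addrTag [] Z), Linked (sideD n L K lv (Prod.snd b).step) 1 (regOf n L K lv c₀ p b) :=
    fun b _ => regOf_linked hL hn b
  have hregN : ∀ b ∈ births (addrTag [] Z),
      ((regOf n L K lv c₀ p b).card : ℝ) ≤ 4 * 2 ^ d * ((((Prod.snd b).fat : ℕ) : ℝ) + 1) :=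
    fun b hb => le_trans (by exact_mod_cast regOf_card_le_tcap hok hb) (tcap_le_real d _)
  have hconn := hconn_zoneP ρ hadm hD
  have hZT := addrTag_ne_renew hZ ([] : List Bool)
  have hftT : ftime (PEv.step ∘ Prod.snd) (addrTag [] Z) ≤ t := by rw [ftime_addrTag]; exact hft
  refine ⟨?_, ?_, ?_, ?_⟩
  · rw [hzone]; exact inRange_regZoneD (sh := Prod.snd) n L K lv c _ t _
  · rw [hzone]
    have hself : addrTag [] Z ∈ parts Prod.snd (ftime (PEv.step ∘ Prod.snd) (addrTag [] Z) + 1) (addrTag [] Z) := by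
      cases Z with
      | born b j => exact self_mem_parts_born _ _ _
      | renew Y e h => exact absurd rfl (hZ Y e h)
      | merge A B e => exact self_mem_parts_merge _ _ (Nat.lt_succ_self _)
    exact linked_regZoneD_pieces hL hlv hchrT hrange hregL hconn hself hftT htK
  · rw [hzone]; exact root_blk_mem_regZoneD hL hn hlv hchr hft hlt
  · rw [hzone, ← zmass_addrTag θ _ _ t [] Z]
    exact card_regZoneD_le_self hL hlv hchrT hrange hregL (by positivity) hregN hconn hs hm hsmall hθ0 hθ1 hθs hZT
      t hftT htK

/-- **THE FOUR READING FACTS FOR ONE CANONICALLY ADMISSIBLY PLACED STRUCTURE** (renewals peeled). [folklore] -/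
theorem facts_zoneP (hL : 1 ≤ L) (hn : 1 ≤ n) (hlv : LevelFn K lv)
    {s m : ℕ} (hs : 1 ≤ s) (hm : ∀ u : ℕ, u + s ≤ K → lv u + m ≤ lv (u + s))
    (hsmall : (((2 * cth c 1 s + 1) ^ d : ℕ) : ℝ) * (5 : ℝ) ^ d * ((max 1 (2 * c + 2) : ℕ) : ℝ) ≤ (L : ℝ) ^ m / 2)
    {θ : ℝ} (hθ0 : 0 ≤ θ) (hθ1 : θ ≤ 1) (hθs : 1 / 2 ≤ θ ^ s) :
    ∀ (Z : Gen PEv), Chrono PEv.step Z → ∀ (s₀ : Bool) (T : ℕ), Dated PEv.step s₀ T Z →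
      p ∈ Sany (zoneP n L K lv c c₀) ρ c₀ PEv.step Z → ∀ t : ℕ, ftime PEv.step Z ≤ t → t ≤ K →
        (zoneP n L K lv c c₀ t Z p).Nonempty →
          InRange (n * L ^ (K - lv t)) (zoneP n L K lv c c₀ t Z p) ∧
            Linked (n * L ^ (K - lv t)) (max 1 (2 * c + 2)) (zoneP n L K lv c c₀ t Z p) ∧
            blk L (lv t) (evalA c₀ p (rootAddr Z)).1 ∈ zoneP n L K lv c c₀ t Z p ∧
            ((zoneP n L K lv c c₀ t Z p).card : ℝ) ≤
              zmass (id : PEv → PEv) θ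
                  (2 * (((2 * cth c 1 s + 1) ^ d : ℕ) : ℝ) * ((((2 * c + 1) ^ d : ℕ) : ℝ) * (4 * 2 ^ d)))
                  (4 * ((((2 * cth c 1 s + 1) ^ d : ℕ) : ℝ) * (5 : ℝ) ^ d)) t Z +
                2 * ((((2 * cth c 1 s + 1) ^ d : ℕ) : ℝ) * (5 : ℝ) ^ d)
  | Gen.renew Y e h, hchr, s₀, T, hD, hp, t, hft, htK, hne => by
      rw [zoneP_renew] at hne ⊢
      rw [sany_renew] at hp
      rw [dated_renew] at hD
      exact facts_zoneP hL hn hlv hs hm hsmall hθ0 hθ1 hθs Y hchr true T hD hp t hft htK hne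
  | Gen.born b j, hchr, s₀, T, hD, hp, t, hft, htK, hne =>
      facts_zoneP_of_ne_renew ρ hL hn hlv (fun _ _ _ h => by cases h) hchr hD hp hs hm hsmall hθ0 hθ1 hθs
        hft htK hne
  | Gen.merge A B e, hchr, s₀, T, hD, hp, t, hft, htK, hne =>
      facts_zoneP_of_ne_renew ρ hL hn hlv (fun _ _ _ h => by cases h) hchr hD hp hs hm hsmall hθ0 hθ1 hθs
        hft htK hne

/-! ## §5 The END's binders for `zoneP` -/

section Laws

variable {G : Gen PEv} {T : ℕ}

/-- **THE FOUR READING FACTS AT THE JOINS** (leaf-02 gen 4's `hfacts` for `zoneP`), for a chronological structure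
dated strictly before `T ≤ K + 1`. [folklore] -/
theorem hfacts_zoneP (hL : 1 ≤ L) (hn : 1 ≤ n) (hlv : LevelFn K lv) (hDt : Dated PEv.step true T G)
    (hT : T ≤ K + 1) (hCh : Chrono PEv.step G)
    {s m : ℕ} (hs : 1 ≤ s) (hm : ∀ u : ℕ, u + s ≤ K → lv u + m ≤ lv (u + s))
    (hsmall : (((2 * cth c 1 s + 1) ^ d : ℕ) : ℝ) * (5 : ℝ) ^ d * ((max 1 (2 * c + 2) : ℕ) : ℝ) ≤ (L : ℝ) ^ m / 2)
    {θ : ℝ} (hθ0 : 0 ≤ θ) (hθ1 : θ ≤ 1) (hθs : 1 / 2 ≤ θ ^ s) :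
    ∀ X ∈ joins PEv.step G, ∀ P ∈ tparts PEv.step X, ∀ p ∈ Sany (zoneP n L K lv c c₀) ρ c₀ PEv.step P,
      (zoneP n L K lv c c₀ (ftime PEv.step X) P p).Nonempty →
        InRange (n * L ^ (K - lv (ftime PEv.step X))) (zoneP n L K lv c c₀ (ftime PEv.step X) P p) ∧
          Linked (n * L ^ (K - lv (ftime PEv.step X))) (max 1 (2 * c + 2)) (zoneP n L K lv c c₀ (ftime PEv.step X) P p) ∧
          blk L (lv (ftime PEv.step X)) (evalA c₀ p (rootAddr P)).1 ∈ zoneP n L K lv c c₀ (ftime PEv.step X) P p ∧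
          ((zoneP n L K lv c c₀ (ftime PEv.step X) P p).card : ℝ) ≤
            zmass (id : PEv → PEv) θ
                (2 * (((2 * cth c 1 s + 1) ^ d : ℕ) : ℝ) * ((((2 * c + 1) ^ d : ℕ) : ℝ) * (4 * 2 ^ d)))
                (4 * ((((2 * cth c 1 s + 1) ^ d : ℕ) : ℝ) * (5 : ℝ) ^ d)) (ftime PEv.step X) P +
              2 * ((((2 * cth c 1 s + 1) ^ d : ℕ) : ℝ) * (5 : ℝ) ^ d) := by
  intro X hX P hP p hp hne
  obtain ⟨A, B, e, rfl⟩ := exists_eq_merge_of_mem_joins PEv.step hX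
  have hXG : Sub (Gen.merge A B e) G := sub_of_mem_joins hX
  have hPX : Sub P (Gen.merge A B e) := sub_of_mem_tparts hP
  have hchrX : Chrono PEv.step (Gen.merge A B e) := chrono_of_sub PEv.step hXG hCh
  have hft : ftime PEv.step P ≤ ftime PEv.step (Gen.merge A B e) := ftime_le_of_sub PEv.step hPX hchrX
  have htK : ftime PEv.step (Gen.merge A B e) ≤ K := by
    have h := (step_le_of_dated_sub hDt hXG).2 rfl
    show PEv.step e ≤ K
    omega
  obtain ⟨s₀, T₀, hDP⟩ := dated_of_sub hDt (hPX.trans hXG)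
  exact facts_zoneP ρ hL hn hlv hs hm hsmall hθ0 hθ1 hθs P (chrono_of_sub PEv.step (hPX.trans hXG) hCh) s₀ T₀ hDP
    hp _ hft htK hne

/-- **THE PER-PLACEMENT CARDINALITY LAW `hlawM` FOR `zoneP`** (all parts of all joins; an empty zone costs
`0 ≤ zmass + γ′`): `WB = 2A₁·C₁·Cr`, `WM = 4A`, `γ′ = 2A`. [folklore] -/
theorem hlawM_zoneP (hL : 1 ≤ L) (hn : 1 ≤ n) (hlv : LevelFn K lv) (hDt : Dated PEv.step true T G)
    (hT : T ≤ K + 1) (hCh : Chrono PEv.step G)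
    {s m : ℕ} (hs : 1 ≤ s) (hm : ∀ u : ℕ, u + s ≤ K → lv u + m ≤ lv (u + s))
    (hsmall : (((2 * cth c 1 s + 1) ^ d : ℕ) : ℝ) * (5 : ℝ) ^ d * ((max 1 (2 * c + 2) : ℕ) : ℝ) ≤ (L : ℝ) ^ m / 2)
    {θ : ℝ} (hθ0 : 0 ≤ θ) (hθ1 : θ ≤ 1) (hθs : 1 / 2 ≤ θ ^ s) :
    ∀ X ∈ joins PEv.step G, ∀ P ∈ tparts PEv.step X, ∀ p ∈ Sany (zoneP n L K lv c c₀) ρ c₀ PEv.step P,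
      ((zoneP n L K lv c c₀ (ftime PEv.step X) P p).card : ℝ) ≤
        zmass (id : PEv → PEv) θ
            (2 * (((2 * cth c 1 s + 1) ^ d : ℕ) : ℝ) * ((((2 * c + 1) ^ d : ℕ) : ℝ) * (4 * 2 ^ d)))
            (4 * ((((2 * cth c 1 s + 1) ^ d : ℕ) : ℝ) * (5 : ℝ) ^ d)) (ftime PEv.step X) P +
          2 * ((((2 * cth c 1 s + 1) ^ d : ℕ) : ℝ) * (5 : ℝ) ^ d) := by
  intro X hX P hP p hp
  rcases (zoneP n L K lv c c₀ (ftime PEv.step X) P p).eq_empty_or_nonempty with h0 | hne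
  · rw [h0, card_empty, Nat.cast_zero]
    exact add_nonneg (zmass_nonneg (sh := (id : PEv → PEv)) hθ0 (by positivity) (by positivity) _ P) (by positivity)
  · exact (hfacts_zoneP ρ hL hn hlv hDt hT hCh hs hm hsmall hθ0 hθ1 hθs X hX P hP p hp hne).2.2.2

/-- **THE CYCLIC-DISTANCE LAW `hlawC` FOR `zoneP`** at the non-host parts of the joins (it holds at every part): every
block of the zone is within `ρℓ·zmass + ρℓ·γ′` of the root cell's level block, `ρℓ = max 1 (2c+2)` — linkedness ×
cardinality (leaf-02 gen 4's `cdist_le_of_linked_real`). [folklore] -/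
theorem hlawC_zoneP (hL : 1 ≤ L) (hn : 1 ≤ n) (hlv : LevelFn K lv) (hDt : Dated PEv.step true T G)
    (hT : T ≤ K + 1) (hCh : Chrono PEv.step G)
    {s m : ℕ} (hs : 1 ≤ s) (hm : ∀ u : ℕ, u + s ≤ K → lv u + m ≤ lv (u + s))
    (hsmall : (((2 * cth c 1 s + 1) ^ d : ℕ) : ℝ) * (5 : ℝ) ^ d * ((max 1 (2 * c + 2) : ℕ) : ℝ) ≤ (L : ℝ) ^ m / 2)
    {θ : ℝ} (hθ0 : 0 ≤ θ) (hθ1 : θ ≤ 1) (hθs : 1 / 2 ≤ θ ^ s) :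
    ∀ (X Y : Gen PEv) (e : PEv), Gen.merge X Y e ∈ joins PEv.step G →
      ∀ i, i ≠ hostIdx PEv.step X Y e →
        ∀ p ∈ Sany (zoneP n L K lv c c₀) ρ c₀ PEv.step (part PEv.step (Gen.merge X Y e) i).2,
          ∀ u ∈ zoneP n L K lv c c₀ e.step (part PEv.step (Gen.merge X Y e) i).2 p,
            ((cdist (n * L ^ (K - lv e.step)) u
                (blk L (lv e.step) (evalA c₀ p (rootAddr (part PEv.step (Gen.merge X Y e) i).2)).1) : ℕ) : ℝ) ≤
              ((max 1 (2 * c + 2) : ℕ) : ℝ) *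
                  zmass (id : PEv → PEv) θ
                    (2 * (((2 * cth c 1 s + 1) ^ d : ℕ) : ℝ) * ((((2 * c + 1) ^ d : ℕ) : ℝ) * (4 * 2 ^ d)))
                    (4 * ((((2 * cth c 1 s + 1) ^ d : ℕ) : ℝ) * (5 : ℝ) ^ d)) e.step
                    (part PEv.step (Gen.merge X Y e) i).2 +
                ((max 1 (2 * c + 2) : ℕ) : ℝ) * (2 * ((((2 * cth c 1 s + 1) ^ d : ℕ) : ℝ) * (5 : ℝ) ^ d)) := by
  intro X Y e hX i _ p hp u hu
  have hP : (part PEv.step (Gen.merge X Y e) i).2 ∈ tparts PEv.step (Gen.merge X Y e) :=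
    List.mem_map.2 ⟨_, part_mem PEv.step _ i, rfl⟩
  obtain ⟨hR, hLk, hroot, hcard⟩ :=
    hfacts_zoneP ρ hL hn hlv hDt hT hCh hs hm hsmall hθ0 hθ1 hθs _ hX _ hP p hp ⟨u, hu⟩
  have h := cdist_le_of_linked_real hR hLk hu hroot hcard
  rw [mul_add] at h
  exact h

/-- **FILE A's ROOT-TEMPLATE LAW IN THE BINDER SHAPE OF `HistoryJoinsPlacedEnd.hlawR_of_laws`** (`κT = 4·2^d`).
[folklore] -/
theorem hlawT_zoneP' (G : Gen PEv) :
    ∀ (X Y : Gen PEv) (e : PEv), Gen.merge X Y e ∈ joins PEv.step G →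
      ∀ i, i ≠ hostIdx PEv.step X Y e →
        ∀ p ∈ Sany (zoneP n L K lv c c₀) ρ c₀ PEv.step (part PEv.step (Gen.merge X Y e) i).2,
          (zoneP n L K lv c c₀ e.step (part PEv.step (Gen.merge X Y e) i).2 p).Nonempty →
            (((evalA c₀ p (rootAddr (part PEv.step (Gen.merge X Y e) i).2)).2.1.card : ℕ) : ℝ) ≤
              4 * 2 ^ d * (((((part PEv.step (Gen.merge X Y e) i).2.root).fat : ℕ) : ℝ) + 1) :=
  fun X Y e _ i _ _ _ hne => hlawT_zoneP (lv := lv) (c := c) (Z := (part PEv.step (Gen.merge X Y e) i).2) hne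

/-! ## §6 The count's END for the concrete zone -/

/-- **ROW S6g′ INSTANCE — THE COUNT's END FOR THE CONCRETE ZONE `zoneP`.**  For every chronological structure
`G : Gen PEv` dated strictly before `T ≤ K + 1`, every root datum `z` (anchor cell, template) and every entropy input
`ENT step G ≤ κE·F + μE·partnerAges + Ξ`:
`#S (zoneP …) ρ c₀ step G z ≤ exp((2 + κM + κρ + κE)·F + Ξ)·(L^d·e^{μE})^{partnerAges step G}` — gen 3's
`card_S_le_exp_pow_placed` with every reading law DISCHARGED (`hzoneW`, `hlawM`, `hlawR` = cyclic-distance law ×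
root-template law, `hΦ`, the template count). [folklore] -/
theorem card_S_le_exp_pow_zoneP (hL : 1 ≤ L) (hn : 1 ≤ n) (hlv : LevelFn K lv) (hDt : Dated PEv.step true T G)
    (hT : T ≤ K + 1) (hCh : Chrono PEv.step G)
    {s m : ℕ} (hs : 1 ≤ s) (hm : ∀ u : ℕ, u + s ≤ K → lv u + m ≤ lv (u + s))
    (hsmall : (((2 * cth c 1 s + 1) ^ d : ℕ) : ℝ) * (5 : ℝ) ^ d * ((max 1 (2 * c + 2) : ℕ) : ℝ) ≤ (L : ℝ) ^ m / 2)
    {θ : ℝ} (hθ0 : 0 ≤ θ) (hθ1 : θ < 1) (hθs : 1 / 2 ≤ θ ^ s) {κE μE Ξ : ℝ}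
    (hENT : ENT PEv.step G ≤
      κE * bsum (fun b => ((b.fat : ℕ) : ℝ) + 1) G + μE * partnerAges PEv.step G + Ξ)
    (z : TCell d (n * L ^ K) × Template d M) :
    ((S (zoneP n L K lv c c₀) ρ c₀ PEv.step G z).card : ℝ) ≤
      Real.exp ((2 +
            ((2 * (((2 * cth c 1 s + 1) ^ d : ℕ) : ℝ) * ((((2 * c + 1) ^ d : ℕ) : ℝ) * (4 * 2 ^ d)) +
                  4 * ((((2 * cth c 1 s + 1) ^ d : ℕ) : ℝ) * (5 : ℝ) ^ d)) / (1 - θ) +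
              2 * (2 * ((((2 * cth c 1 s + 1) ^ d : ℕ) : ℝ) * (5 : ℝ) ^ d))) +
            (2 * ((0 + 2 * Real.log (2 * d + 1)) + (2 * (d : ℝ) + 2 * Real.log (2 * d + 1)) *
                  (((max 1 (2 * c + 2) : ℕ) : ℝ) * (2 * ((((2 * cth c 1 s + 1) ^ d : ℕ) : ℝ) * (5 : ℝ) ^ d)))) +
              (2 * (d : ℝ) + 2 * Real.log (2 * d + 1)) * 1 *
                (((max 1 (2 * c + 2) : ℕ) : ℝ) *
                    ((2 * (((2 * cth c 1 s + 1) ^ d : ℕ) : ℝ) * ((((2 * c + 1) ^ d : ℕ) : ℝ) * (4 * 2 ^ d)) +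
                        4 * ((((2 * cth c 1 s + 1) ^ d : ℕ) : ℝ) * (5 : ℝ) ^ d)) / (1 - θ)) +
                  4 * 2 ^ d)) +
            κE) * bsum (fun b => ((b.fat : ℕ) : ℝ) + 1) G + Ξ) *
        (((L : ℝ) ^ d) * Real.exp μE) ^ partnerAges PEv.step G := by
  have hρ0 : (0 : ℝ) ≤ ((max 1 (2 * c + 2) : ℕ) : ℝ) := Nat.cast_nonneg _
  have hd₁ : (0 : ℝ) ≤ 2 * Real.log (2 * d + 1) :=
    mul_nonneg (by norm_num) (Real.log_nonneg (by norm_cast; omega))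
  exact card_S_le_exp_pow_placed (id : PEv → PEv) lv (fun T : Template d M => T.1.card) (zoneP n L K lv c c₀) ρ c₀
    hL hlv (fun t Z q u _ hu => hzoneW_zoneP t Z q u hu) (A := A d M) (fun m => le_rfl) le_rfl hd₁
    (fun m => by rw [zero_add]; exact A_le_exp d M m) hθ0 hθ1 (by positivity) (by positivity) (by positivity)
    zero_le_one (mul_nonneg hρ0 (by positivity)) hDt hCh
    (hlawM_zoneP ρ hL hn hlv hDt hT hCh hs hm hsmall hθ0 hθ1.le hθs)
    (fun t P => ((max 1 (2 * c + 2) : ℕ) : ℝ) *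
        zmass (id : PEv → PEv) θ
          (2 * (((2 * cth c 1 s + 1) ^ d : ℕ) : ℝ) * ((((2 * c + 1) ^ d : ℕ) : ℝ) * (4 * 2 ^ d)))
          (4 * ((((2 * cth c 1 s + 1) ^ d : ℕ) : ℝ) * (5 : ℝ) ^ d)) t P +
      4 * 2 ^ d * (((P.root.fat : ℕ) : ℝ) + 1))
    (fun t P => add_nonneg (mul_nonneg hρ0 (zmass_nonneg (sh := (id : PEv → PEv)) hθ0 (by positivity)
      (by positivity) t P)) (by positivity))
    (hlawR_of_laws (id : PEv → PEv) lv (fun T : Template d M => T.1.card) (zoneP n L K lv c c₀) ρ c₀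
      (hlawC_zoneP ρ hL hn hlv hDt hT hCh hs hm hsmall hθ0 hθ1.le hθs) (hlawT_zoneP' ρ G))
    (total_potential_le (id : PEv → PEv) hθ0 hθ1 (by positivity) (by positivity) hρ0 (by positivity) hDt hCh)
    hENT z

end Laws

end

end Summit.QuantumFields.BalabanUV.T4Continuum.HistoryJoinsPlacedLaws
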